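import Summits.FinalStateConjecture.FinalStateConjecture.Theorems.EIHFluxBalanceInertialRecessionStubWeightedRatesReductionE0
import Mathlib.Analysis.Calculus.MeanValue

/-!
# Route EIHFluxBalance — item `WeightedQuasiStationarity` (stmt-FinalStateConjecture-16928):
# QS from WEIGHTED CONVERGENCE of the painted 4-velocities plus the weighted second-order rate

Helper file of the prover seated on the route item `WeightedQuasiStationarity`
(stmt-FinalStateConjecture-16928), `--supports stmt-FinalStateConjecture-16928`; a sufficient
condition for the item's conclusion that splits its missing dynamical input (the weighted 4-velocity
rate RATES_E0 `t^{3/4}‖(Λᵢe₀)˙‖ → 0`, necessary for one hole by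
`…StubWeightedRatesNecessityQS.weightedRate_e0_of_QS_one`) into an order-`0` and an order-`2`
statement:

* `norm_deriv_le_of_norm_sub_le_of_norm_iteratedDeriv_two_le` — Landau–Kolmogorov on a unit window:
  `‖ḟ(t)‖ ≤ 2 S₀ + S₂` if `‖f − c‖ ≤ S₀` and `‖f̈‖ ≤ S₂` on `[t, t + 1]` (mean value inequality twice);
* `weightedRate_of_weightedConvergence` — hence `t^{3/4}‖f(t) − c‖ → 0` and `t^{3/4}‖f̈(t)‖ → 0`
  imply `t^{3/4}‖ḟ(t)‖ → 0`;
* `weightedQuasiStationarity_of_weightedConvergence` — the item's signature VERBATIM with two extra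
  hypotheses inserted after the slaving block: WCONV `∀ i, ∃ u∞, t^{3/4}‖Λᵢ(t)e₀ − u∞‖ → 0` (the
  painted 4-velocities converge at the weighted rate — an order-`0`, chart-level clause a constructor
  of the lab chart can certify) and WJET₂ `∀ i, t^{3/4}‖(Λᵢe₀)¨(t)‖ → 0` (the weighted second-order
  rate, the part of the input that the weighted Ricci-flatness of the ansatz at the top scale is
  expected to control); proof: WCONV ∧ WJET₂ ⇒ RATES_E0 per hole, then the landed reduction
  `…StubWeightedRatesReductionE0.stub_quasiStationarity_of_weightedRates_e0`.

Neither extra hypothesis follows from the item's antecedent in the tree (see the negative lane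
`…WeightedQuasiStationarity.Negative.KinematicShadow` and the item's evidence note); the file records
one honest restatement option for the planner.
-/

set_option linter.dupNamespace false

noncomputable section

namespace Summit.FinalStateConjecture.FinalStateConjecture.Theorems.EIHFluxBalance.WeightedQuasiStationarity

open scoped Topology ENNReal Manifold
open Filter Set Function TopologicalSpace Literature.Geometry.Lorentzian
open Summit.FinalStateConjecture.FinalStateConjecture.Theorems
open Summit.FinalStateConjecture.FinalStateConjecture.Theorems.SublinearIsFree.WeightedRates

/-! ### Landau–Kolmogorov on a unit window -/

/-- **Landau–Kolmogorov on a unit window.** For a `C²` map `f : ℝ → E`: if `‖f(s) − c‖ ≤ S₀` and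
`‖f̈(s)‖ ≤ S₂` for `s ∈ [t, t + 1]`, then `‖ḟ(t)‖ ≤ 2 S₀ + S₂`. Proof: `g(s) = f(s) − (s − t) • ḟ(t)`
has `ġ(s) = ḟ(s) − ḟ(t)`, of norm `≤ S₂ (s − t) ≤ S₂` on the window by the mean value inequality for
`ḟ`; so `‖f(t+1) − f(t) − ḟ(t)‖ = ‖g(t+1) − g(t)‖ ≤ S₂`. Landau, Proc. LMS 13 (1913); Kolmogorov 1939
(here only the trivial window form). [folklore] -/
theorem norm_deriv_le_of_norm_sub_le_of_norm_iteratedDeriv_two_le {E : Type*}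
    [NormedAddCommGroup E] [NormedSpace ℝ E] {f : ℝ → E} (hf : ContDiff ℝ 2 f) {t S₀ S₂ : ℝ}
    {c : E} (h0 : ∀ s ∈ Icc t (t + 1), ‖f s - c‖ ≤ S₀)
    (h2 : ∀ s ∈ Icc t (t + 1), ‖iteratedDeriv 2 f s‖ ≤ S₂) :
    ‖deriv f t‖ ≤ 2 * S₀ + S₂ := by
  have hS₂ : 0 ≤ S₂ := (norm_nonneg _).trans (h2 t ⟨le_rfl, by linarith⟩)
  have hd1 : Differentiable ℝ f := hf.differentiable (by norm_num)
  have hd2 : Differentiable ℝ (deriv f) := by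
    have h := hf.iterate_deriv' 1 1
    simp only [Function.iterate_one] at h
    exact h.differentiable (by norm_num)
  have hconv : Convex ℝ (Icc t (t + 1)) := convex_Icc _ _
  -- mean value inequality for `ḟ` on the window
  have hmv1 : ∀ s ∈ Icc t (t + 1), ‖deriv f s - deriv f t‖ ≤ S₂ := by
    intro s hs
    have h := hconv.norm_image_sub_le_of_norm_deriv_le (f := deriv f) (C := S₂)
      (fun x _ ↦ hd2 x) (fun x hx ↦ ?_) ⟨le_rfl, by linarith⟩ hs
    · refine h.trans ?_
      rw [Real.norm_eq_abs, abs_of_nonneg (by linarith [hs.1])]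
      nlinarith [hs.1, hs.2]
    · have := h2 x hx
      rwa [iteratedDeriv_succ, iteratedDeriv_one] at this
  -- the auxiliary map `g(s) = f(s) − (s − t) • ḟ(t)`
  have hgd : ∀ s, HasDerivAt (fun s ↦ f s - (s - t) • deriv f t) (deriv f s - deriv f t) s :=
    fun s ↦ by
    have h1 : HasDerivAt (fun s ↦ (s - t) • deriv f t) ((1 : ℝ) • deriv f t) s :=
      ((hasDerivAt_id s).sub_const t).smul_const _
    have h := ((hd1 s).hasDerivAt).sub h1
    rw [one_smul] at h
    exact h
  have hmv2 : ‖(f (t + 1) - (t + 1 - t) • deriv f t) - (f t - (t - t) • deriv f t)‖ ≤ S₂ := by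
    have h := hconv.norm_image_sub_le_of_norm_deriv_le (f := fun s ↦ f s - (s - t) • deriv f t)
      (C := S₂) (fun x _ ↦ (hgd x).differentiableAt) (fun x hx ↦ ?_) ⟨le_rfl, by linarith⟩
      ⟨by linarith, le_rfl⟩
    · simpa using h
    · rw [(hgd x).deriv]
      exact hmv1 x hx
  have hid : (f (t + 1) - (t + 1 - t) • deriv f t) - (f t - (t - t) • deriv f t) =
      (f (t + 1) - c) - (f t - c) - deriv f t := by
    simp only [sub_self, zero_smul, sub_zero, add_sub_cancel_left, one_smul]
    abel
  rw [hid] at hmv2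
  have ht0 := h0 t ⟨le_rfl, by linarith⟩
  have ht1 := h0 (t + 1) ⟨by linarith, le_rfl⟩
  have h' : ‖deriv f t‖ ≤ ‖(f (t + 1) - c) - (f t - c)‖ + ‖(f (t + 1) - c) - (f t - c) - deriv f t‖ := by
    have := norm_sub_le ((f (t + 1) - c) - (f t - c)) ((f (t + 1) - c) - (f t - c) - deriv f t)
    simpa using this
  have h'' : ‖(f (t + 1) - c) - (f t - c)‖ ≤ S₀ + S₀ := (norm_sub_le _ _).trans (add_le_add ht1 ht0)
  linarith

/-! ### Weighted convergence plus the weighted second-order rate give the weighted first-order rate -/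

/-- **Weighted interpolation.** For a `C²` map `f : ℝ → E`: if `t^{3/4}‖f(t) − c‖ → 0` and
`t^{3/4}‖f̈(t)‖ → 0` then `t^{3/4}‖ḟ(t)‖ → 0` (Landau–Kolmogorov on `[t, t+1]`, where both bounds are
`≤ (ε/4) t^{-3/4}` eventually since `s^{-3/4} ≤ t^{-3/4}` for `s ≥ t`). [folklore] -/
theorem weightedRate_of_weightedConvergence {E : Type*} [NormedAddCommGroup E] [NormedSpace ℝ E]
    {f : ℝ → E} (hf : ContDiff ℝ 2 f) (c : E)
    (h0 : Tendsto (fun t : ℝ ↦ t ^ (3 / 4 : ℝ) * ‖f t - c‖) atTop (𝓝 0))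
    (h2 : Tendsto (fun t : ℝ ↦ t ^ (3 / 4 : ℝ) * ‖iteratedDeriv 2 f t‖) atTop (𝓝 0)) :
    Tendsto (fun t : ℝ ↦ t ^ (3 / 4 : ℝ) * ‖deriv f t‖) atTop (𝓝 0) := by
  rw [Metric.tendsto_nhds]
  intro ε hε
  have hε4 : 0 < ε / 4 := by positivity
  have e0 := (Metric.tendsto_nhds.mp h0) (ε / 4) hε4
  have e2 := (Metric.tendsto_nhds.mp h2) (ε / 4) hε4
  obtain ⟨T, hT⟩ := ((e0.and e2).and (eventually_ge_atTop 1)).exists_forall_of_atTop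
  filter_upwards [eventually_ge_atTop T, eventually_ge_atTop (1 : ℝ)] with t htT ht1
  have ht0 : 0 < t := one_pos.trans_le ht1
  have hw : 0 < t ^ (3 / 4 : ℝ) := Real.rpow_pos_of_pos ht0 _
  -- pointwise bounds on the window `[t, t+1]`
  have hwin : ∀ s ∈ Icc t (t + 1), ‖f s - c‖ ≤ ε / 4 * (t ^ (3 / 4 : ℝ))⁻¹ ∧
      ‖iteratedDeriv 2 f s‖ ≤ ε / 4 * (t ^ (3 / 4 : ℝ))⁻¹ := by
    intro s hs
    obtain ⟨⟨hs0, hs2⟩, hs1⟩ := hT s (htT.trans hs.1)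
    rw [dist_zero_right, Real.norm_eq_abs] at hs0 hs2
    have hsw : 0 < s ^ (3 / 4 : ℝ) := Real.rpow_pos_of_pos (one_pos.trans_le hs1) _
    have hmono : t ^ (3 / 4 : ℝ) ≤ s ^ (3 / 4 : ℝ) :=
      Real.rpow_le_rpow ht0.le hs.1 (by norm_num)
    have hinv : (s ^ (3 / 4 : ℝ))⁻¹ ≤ (t ^ (3 / 4 : ℝ))⁻¹ := by
      rw [inv_le_inv₀ hsw hw]; exact hmono
    have k0 : ‖f s - c‖ ≤ ε / 4 * (s ^ (3 / 4 : ℝ))⁻¹ := by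
      rw [abs_of_nonneg (by positivity)] at hs0
      rw [le_mul_inv_iff₀ hsw]
      nlinarith [norm_nonneg (f s - c)]
    have k2 : ‖iteratedDeriv 2 f s‖ ≤ ε / 4 * (s ^ (3 / 4 : ℝ))⁻¹ := by
      rw [abs_of_nonneg (by positivity)] at hs2
      rw [le_mul_inv_iff₀ hsw]
      nlinarith [norm_nonneg (iteratedDeriv 2 f s)]
    exact ⟨k0.trans (mul_le_mul_of_nonneg_left hinv hε4.le),
      k2.trans (mul_le_mul_of_nonneg_left hinv hε4.le)⟩
  have hLK := norm_deriv_le_of_norm_sub_le_of_norm_iteratedDeriv_two_le hf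
    (fun s hs ↦ (hwin s hs).1) (fun s hs ↦ (hwin s hs).2)
  rw [dist_zero_right, Real.norm_eq_abs, abs_of_nonneg (by positivity)]
  calc t ^ (3 / 4 : ℝ) * ‖deriv f t‖
      ≤ t ^ (3 / 4 : ℝ) * (2 * (ε / 4 * (t ^ (3 / 4 : ℝ))⁻¹) + ε / 4 * (t ^ (3 / 4 : ℝ))⁻¹) :=
        mul_le_mul_of_nonneg_left hLK hw.le
    _ = 3 * ε / 4 := by field_simp; ring
    _ < ε := by linarith

/-! ### The item's conclusion from weighted convergence plus the weighted second-order rate -/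

-- operator-norm instance paths on form-valued maps are slow to unify
set_option synthInstance.maxHeartbeats 200000 in
set_option maxHeartbeats 1600000 in
/-- **QS from weighted convergence of the painted 4-velocities (one restatement option for the item
`WeightedQuasiStationarity`).** The signature of item stmt-FinalStateConjecture-16928 VERBATIM, with two
extra hypotheses inserted after the third-order slaving block: WCONV — every painted 4-velocity
converges at the weighted rate, `∃ u∞, t^{3/4}‖Λᵢ(t)e₀ − u∞‖ → 0` — and WJET₂ — the weighted
second-order rate `t^{3/4}‖(Λᵢe₀)¨(t)‖ → 0`. By Landau–Kolmogorov on unit windows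
(`weightedRate_of_weightedConvergence`) they give the weighted 4-velocity rate RATES_E0 of every hole,
and the landed reduction `stub_quasiStationarity_of_weightedRates_e0` concludes. (Neither WCONV nor
WJET₂ is derived from the antecedent here; WCONV is an order-`0` clause a constructor of the lab
chart certifies, WJET₂ the part expected from the weighted Ricci-flatness of the ansatz at the top
scale.) [folklore] -/
theorem weightedQuasiStationarity_of_weightedConvergence :
    open Literature.Geometry.Lorentzian in ∀ (X : Type) [TopologicalSpace X] [ChartedSpace E3 X] [IsManifold (𝓡 3) ((⊤ : ℕ∞) : WithTop ℕ∞) X] [T2Space X] [SecondCountableTopology X] [ConnectedSpace X], ∀ D ∈ admissibleVacuumData X, ∀ 𝒟 : VacuumCauchyDevelopment D, 𝒟.IsMaximal → ∀ (N : ℕ) (M a rin : Fin N → ℝ) (Λ : Fin N → ℝ → lorentzGroup) (ξ : Fin N → ℝ → E3) (γ κ τ₀ : ℝ) (U : Opens E4) (Φ : U → 𝒟.carrier) (O : Set 𝒟.carrier), ((∀ i, Kerr.IsSubextremal (M i) (a i) ∧ Kerr.rMinus (M i) (a i) < rin i ∧ rin i < Kerr.rPlus (M i) (a i)) ∧ (∀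 i t, |((Λ i t : E4 ≃L[ℝ] E4) (E4.basisVector 0)) 0| ≤ γ) ∧ (∀ i, ContDiff ℝ ((⊤ : ℕ∞) : WithTop ℕ∞) (ξ i) ∧ ContDiff ℝ ((⊤ : ℕ∞) : WithTop ℕ∞) (fun t ↦ ((Λ i t : E4 ≃L[ℝ] E4) : E4 →L[ℝ] E4))) ∧ (∀ i j, i ≠ j → Tendsto (fun t ↦ ‖ξ i t - ξ j t‖) atTop atTop) ∧ (0 < κ ∧ κ < 1 ∧ ∀ i, ∀ᶠ t in atTop, ‖ξ i t‖ ≤ κ ^ 2 * t) ∧ ({x : E4 | τ₀ < x 0 ∧ ∀ i, rin i < Kerr.radius (a i) (poincareInv (Λ i (x 0)) (E4.ofTimeSpace (x 0) (ξ i (x 0))) x)} ⊆ (U : Set E4)) ∧ let B : ModelBackground := ⟨U, fun x ↦ Minkowski.bilin + ∑ i, (boostedKerrBilin (Λ i (x 0)) (E4.ofTimeSpace (x 0) (ξ i (x 0))) (M i) (a i) x - Minkowski.bilin), fun x ↦ x 0, E4.spatialNorm⟩; ContMDiff 𝓘(ℝ, E4) (𝓡 4) ((⊤ : ℕ∞)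 : WithTop ℕ∞) Φ ∧ Topology.IsOpenEmbedding ((B.lateRegion τ₀).restrict Φ) ∧ Φ '' {x : U | τ₀ < x.1 0 ∧ ∀ i, Kerr.rPlus (M i) (a i) < Kerr.radius (a i) (poincareInv (Λ i (x.1 0)) (E4.ofTimeSpace (x.1 0) (ξ i (x.1 0))) x.1)} ⊆ O ∧ Tendsto (fun t ↦ 𝒟.toSpacetime.deviationCk B Φ 3 t) atTop (𝓝 0) ∧ Tendsto (fun t : ℝ ↦ ⨆ x ∈ {x : U | x.1 0 = t ∧ E4.spatialNorm x.1 ≤ κ * t}, ⨆ (m : ℕ) (_ : m ≤ 3), ENNReal.ofReal (1 + √(√((⨅ i, ‖E4.spatial x.1 - ξ i t‖) ^ 7))) * ‖iteratedFDeriv ℝ m (𝒟.toSpacetime.deviationExtend B Φ) x.1‖ₑ) atTop (𝓝 0) ∧ O = Summit.FinalStateConjecture.exteriorOf 𝒟.toCauchyDevelopment (Φ '' {x : U | τ₀ < x.1 0 ∧ ∀ i, Kerr.rPlus (M i) (a i) < Kerr.radius (a i) (poincareInv (Λ i (x.1 0)) (E4.ofTimeSpace (x.1 0) (ξ i (x.1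 0))) x.1)}) ∧ ∀ t₁ : ℝ, τ₀ < t₁ → O \ Φ '' {x : U | t₁ < x.1 0 ∧ ∀ i, Kerr.rPlus (M i) (a i) < Kerr.radius (a i) (poincareInv (Λ i (x.1 0)) (E4.ofTimeSpace (x.1 0) (ξ i (x.1 0))) x.1)} ⊆ 𝒟.metric.causalPast 𝒟.timeOrientation (Φ '' {x : U | x.1 0 = t₁ ∧ ∀ i, Kerr.rPlus (M i) (a i) < Kerr.radius (a i) (poincareInv (Λ i (x.1 0)) (E4.ofTimeSpace (x.1 0) (ξ i (x.1 0))) x.1)})) → 0 < N → (∀ i : Fin N, (∀ m : ℕ, 1 ≤ m → m ≤ 3 → Tendsto (fun t ↦ iteratedDeriv m (fun s ↦ (((Λ i s : lorentzGroup) : E4 ≃L[ℝ] E4) (E4.basisVector 0))) t) atTop (𝓝 0)) ∧ (∀ m : ℕ, m ≤ 2 → Tendsto (fun t ↦ iteratedDeriv m (fun s ↦ deriv (ξ i) s - (((((Λ i s : lorentzGroup) : E4 ≃L[ℝ] E4) (E4.basisVector 0)) 0)⁻¹ • E4.spatial (((Λ i s : lorentzGroup) : E4 ≃L[ℝ] E4)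 (E4.basisVector 0)))) t) atTop (𝓝 0)) ∧ (a i ≠ 0 → ∀ m : ℕ, 1 ≤ m → m ≤ 3 → Tendsto (fun t ↦ iteratedDeriv m (fun s ↦ (((Λ i s : lorentzGroup) : E4 ≃L[ℝ] E4) (E4.basisVector 3))) t) atTop (𝓝 0))) → (∀ i : Fin N, ∃ uinf : E4, Tendsto (fun t : ℝ ↦ t ^ (3 / 4 : ℝ) * ‖(((Λ i t : lorentzGroup) : E4 ≃L[ℝ] E4) (E4.basisVector 0)) - uinf‖) atTop (𝓝 0)) → (∀ i : Fin N, Tendsto (fun t : ℝ ↦ t ^ (3 / 4 : ℝ) * ‖iteratedDeriv 2 (fun s ↦ (((Λ i s : lorentzGroup) : E4 ≃L[ℝ] E4) (E4.basisVector 0))) t‖) atTop (𝓝 0)) → (∀ ρ : ℝ → ℝ, Tendsto ρ atTop atTop → Tendsto (fun t : ℝ ↦ ⨆ x ∈ {x : E4 | x 0 = t ∧ E4.spatialNorm x ≤ κ * t ∧ ρ t ≤ ⨅ i, ‖E4.spatial x - ξ i t‖}, ENNReal.ofReal (1 + √(√((⨅ i, ‖E4.spatial x - ξ i t‖) ^ 7)))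 * ‖fderiv ℝ (fun y : E4 ↦ Minkowski.bilin + ∑ i, (boostedKerrBilin (Λ i (y 0)) (E4.ofTimeSpace (y 0) (ξ i (y 0))) (M i) (a i) y - Minkowski.bilin)) x (E4.basisVector 0)‖ₑ) atTop (𝓝 0)) := by
  intro X _ _ _ _ _ _ D hD 𝒟 h𝒟 N M a rin Λ ξ γ κ τ₀ U Φ O hant _hN hslaved hconv hjet
  refine stub_quasiStationarity_of_weightedRates_e0 X D hD 𝒟 h𝒟 N M a rin Λ ξ γ κ τ₀ U Φ O hant
    hslaved (fun i ↦ ?_)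
  obtain ⟨uinf, hu⟩ := hconv i
  have hsm : ContDiff ℝ 2 (fun s ↦ (((Λ i s : lorentzGroup) : E4 ≃L[ℝ] E4) (E4.basisVector 0))) :=
    ((hant.2.2.1 i).2.clm_apply contDiff_const).of_le (WithTop.coe_le_coe.mpr le_top)
  exact weightedRate_of_weightedConvergence hsm uinf hu (hjet i)

end Summit.FinalStateConjecture.FinalStateConjecture.Theorems.EIHFluxBalance.WeightedQuasiStationarity

end
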